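import Summits.AtomisticToContinuum.FouriersLaw.Theses.EmbeddedDrudeMourre
import Summits.AtomisticToContinuum.FouriersLaw.Theses.StaticAbelianSqueeze
import Literature.MathematicalPhysics.KineticTheory.LangevinChainNESSHolds
import Literature.MathematicalPhysics.KineticTheory.InfiniteChainSuperstableOrbits
import Literature.MathematicalPhysics.KineticTheory.InfiniteChainTightRegular
import Summits.AtomisticToContinuum.FouriersLaw.Theorems.FourierGreenKuboFourierFiniteResponseOfUnique
import Summits.AtomisticToContinuum.FouriersLaw.Theorems.EmbeddedDrudeMourreGreenKuboContinuationCanonicalSeedOfRegularState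
import Summits.AtomisticToContinuum.FouriersLaw.Theorems.EmbeddedDrudeMourreGreenKuboContinuationHeatableInfrastructure
import Summits.AtomisticToContinuum.FouriersLaw.Theorems.EmbeddedDrudeMourreAbelThermodynamicLimitRegularDLRUnique
import Summits.AtomisticToContinuum.FouriersLaw.Theorems.EmbeddedDrudeMourreAbelThermodynamicLimitAnchoredKuboUniformMixing
import Summits.AtomisticToContinuum.FouriersLaw.Theorems.EmbeddedDrudeMourreAbelThermodynamicLimitUniformMixing
import Summits.AtomisticToContinuum.FouriersLaw.Theorems.EmbeddedDrudeMourreAbelThermodynamicLimitFixedFrequencyMatching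
import Summits.AtomisticToContinuum.FouriersLaw.Theorems.EmbeddedDrudeMourreAbelThermodynamicLimitAnchoredDcLimitOfRegularity
import HarnessLib

/-!
# The crux `EmbeddedDrudeMourre.AbelThermodynamicLimit` modulo TWO EXISTING ITEMS, and the necessity of its positivity half
(line `loomis-compact-horizon-witness`, rev 5; item stmt-AtomisticToContinuum-12596; `--supports` file, closes nothing)

Write `P = pinnedChain ω₂ lam β γ` (all `> 0`), `T > 0`; open `N`-chain with both baths at `T`: `c_N(t) = ∫ J · P_t J dμ_{N,T}`,
`F_N(ν) = ∫₀^∞ e^{-νt} c_N`, `A_N(0)` the anchored DC value (`Σ_k ∫₀^∞ ⟨j_{c_N}(0) j_k(t)⟩ dt`, central bond), `D_N` the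
response coefficients of a steady family; regular pair `(μ*, D*)` = transfer-operator DLR state + Buttà–Marchioro flow.

Landed inputs used BY NAME: (M) `stub_fixedFrequencyMatching` (p127009: `F_N(ν)/N → ∫₀^∞e^{-νt}C_{D}` for regular pairs),
A `stub_anchoredDcLimitOfRegularity` (p126906: (R) + (M) ⇒ common limit `L` of `A_N(0)` and of the Abel function at `0⁺`),
S3 `stub_anchoredKuboOfUniformMixing` + `stub_uniformMixing` (anchored open-chain Kubo formula `T²D_N = A_N(0)`),
S7 `stub_regularDLRUnique`, `stub_heatableInfrastructure` (the regular pair exists), `finiteResponse_of_unique`,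
`pinnedChain_exists_isSteadyState`, `regularWitness_of_regularState_of_aeOrbits`.

## Results (all sorry-free; (R) = `StaticAbelianSqueeze.UniformAbelianRegularity` (stmt-13416) and
## CLB = `StaticAbelianSqueeze.ConductanceLowerBound` (stmt-11749) enter only as HYPOTHESES, by name)

* `stub_lowerBoundOfCrux` — NECESSITY, uses nothing: the crux implies, at every `T` carrying an Abelian witness,
  the conclusion of CLB at `T` (`D_N ≥ κ/2 > 0` eventually along every steady family).
* `exists_regularPair_commonLimit_of_regularity` — (R) ⇒ there are a regular pair `(μ*, D*)` and `L` with
  `∫₀^∞e^{-νt}C_{D*} → L` (`ν ↓ 0`) and `T²·D_N → L` along EVERY steady family.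
* `stub_repairedCruxOfRegularity` — (R) ⇒ the REPAIRED crux (hypothesis witness clause with `IsShiftInvariant μT`,
  the planner-level repair recommended by every seat): the seam route, no CLB needed (`L = T²κ`).
* `stub_cruxOfRegularityOfLowerBound` — **(R) → CLB → crux** (the crux BY NAME): output `(μ*, D*, L/T²)`,
  `0 < L` from CLB along the canonical CEHR steady family.  When stmt-13416 and stmt-11749 close, `AbelThermodynamicLimit_holds`
  is this theorem applied to their `_holds` links.

Consequently, modulo (R): crux ⟺ [Abelian witness at `T` ⇒ `liminf_N D_N(T) > 0`]; the seam "WLOG the witness state is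
shift-invariant" (rev-4 stub SI, undecidable in the tree as typed) is sufficient but NOT load-bearing.
References: Kundu–Dhar–Narayan 2009 (arXiv:0809.4543) eqs. (8)–(15); Bonetto–Lebowitz–Rey-Bellet 2000 §7 eq. (37);
Cuneo–Eckmann–Hairer–Rey-Bellet 2018 Thm 2.13.  No definitions, no named facts.
-/

noncomputable section

open MeasureTheory Filter Set
open scoped Topology NNReal BigOperators

namespace Summit.AtomisticToContinuum.FouriersLaw.Theorems.AbelThermodynamicLimit.LoomisCompactHorizonWitness

open Literature.MathematicalPhysics.KineticTheory.HeatConduction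

/-! ## §1 The canonical steady family; necessity of the positivity half -/

/-- **The canonical steady family and its responses at `T`.**  For `P` (all `> 0`), weak-NESS uniqueness and `T > 0`
there is a steady-state family (CEHR 2018: `pinnedChain_exists_isSteadyState`; junk `0` at non-positive bath temperatures,
where the family clause asks nothing) together with its response coefficients at `T` (`finiteResponse_of_unique`,
the Kundu–Dhar–Narayan open-chain Green–Kubo identity). [cite: CuneoEckmannHairerReyBellet2018, Thm 2.13]
[cite: KunduDharNarayan2009, p. 3] -/
theorem exists_steadyFamily_response (ω₂ lam β γ : ℝ) (hω : 0 < ω₂) (hl : 0 < lam) (hβ : 0 < β) (hγ : 0 < γ)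
    (hU : ∀ (N : ℕ) (T_L T_R : ℝ), 0 < T_L → 0 < T_R → ∀ μ ν : Measure (PhaseSpace N),
      (pinnedChain ω₂ lam β γ).IsSteadyState N T_L T_R μ → (pinnedChain ω₂ lam β γ).IsSteadyState N T_L T_R ν → μ = ν)
    (T : ℝ) (hT : 0 < T) :
    ∃ (μ : (N : ℕ) → ℝ → ℝ → Measure (PhaseSpace N)) (Dn : ℕ → ℝ),
      (∀ (N : ℕ) (T_L T_R : ℝ), 0 < T_L → 0 < T_R →
        (pinnedChain ω₂ lam β γ).IsSteadyState N T_L T_R (μ N T_L T_R)) ∧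
      ∀ N : ℕ, Tendsto (fun δ : ℝ => (pinnedChain ω₂ lam β γ).totalCurrent (μ N (T + δ / 2) (T - δ / 2)) / δ)
        (nhdsWithin 0 {(0 : ℝ)}ᶜ) (𝓝 (Dn N)) := by
  classical
  have hex : ∀ (N : ℕ) (T_L T_R : ℝ), ∃ μ : Measure (PhaseSpace N),
      0 < T_L → 0 < T_R → (pinnedChain ω₂ lam β γ).IsSteadyState N T_L T_R μ := by
    intro N T_L T_R
    by_cases h : 0 < T_L ∧ 0 < T_R
    · obtain ⟨μ, hμ⟩ := pinnedChain_exists_isSteadyState hω hl hβ hγ N h.1 h.2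
      exact ⟨μ, fun _ _ => hμ⟩
    · exact ⟨0, fun h1 h2 => (h ⟨h1, h2⟩).elim⟩
  choose μ hμ using hex
  have hD := Summit.AtomisticToContinuum.FouriersLaw.Theorems.FourierGreenKubo.finiteResponse_of_unique
    ω₂ lam β γ hω hl hβ hγ hU μ hμ T hT
  choose Dn hDn using hD
  exact ⟨μ, Dn, hμ, hDn⟩

/-- **NECESSITY of the positivity half (uses nothing).**  The crux implies, at every `T > 0` carrying an Abelian Green–Kubo
witness, the conclusion of `StaticAbelianSqueeze.ConductanceLowerBound` at `T`: along every steady family with responses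
`Dn`, `Dn N ≥ c > 0` eventually (`c = κ/2`, from `Dn → κ > 0`). [folklore] -/
theorem stub_lowerBoundOfCrux :
    Summit.AtomisticToContinuum.FouriersLaw.Theses.EmbeddedDrudeMourre.AbelThermodynamicLimit →
      ∀ ω₂ lam β γ : ℝ, 0 < ω₂ → 0 < lam → 0 < β → 0 < γ →
      (∀ (N : ℕ) (T_L T_R : ℝ), 0 < T_L → 0 < T_R →
        ∀ μ ν : MeasureTheory.Measure (Literature.MathematicalPhysics.KineticTheory.HeatConduction.PhaseSpace N),
          (Literature.MathematicalPhysics.KineticTheory.HeatConduction.pinnedChain ω₂ lam β γ).IsSteadyState N T_L T_R μ →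
          (Literature.MathematicalPhysics.KineticTheory.HeatConduction.pinnedChain ω₂ lam β γ).IsSteadyState N T_L T_R ν → μ = ν) →
      ∀ T : ℝ, 0 < T →
        (∃ (μT : MeasureTheory.Measure Literature.MathematicalPhysics.KineticTheory.HeatConduction.ChainConfig)
            (D : Literature.MathematicalPhysics.KineticTheory.HeatConduction.InfiniteChainDynamics
              (Literature.MathematicalPhysics.KineticTheory.HeatConduction.pinnedChain ω₂ lam β γ)) (κ : ℝ),
          (Literature.MathematicalPhysics.KineticTheory.HeatConduction.pinnedChain ω₂ lam β γ).IsChainGibbsMeasure T μT ∧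
          D.PreservesMeasure μT ∧ (∀ t : ℝ, D.HasAbsConvergentCorrelation μT t) ∧ 0 < κ ∧
          Filter.Tendsto (fun ν : ℝ => (T ^ 2)⁻¹ *
            MeasureTheory.integral (MeasureTheory.volume.restrict (Set.Ioi (0:ℝ)))
              (fun t : ℝ => Real.exp (-(ν * t)) * D.currentCorrelation μT t))
            (nhdsWithin (0:ℝ) (Set.Ioi 0)) (nhds κ)) →
        ∀ μ : (N : ℕ) → ℝ → ℝ → MeasureTheory.Measure (Literature.MathematicalPhysics.KineticTheory.HeatConduction.PhaseSpace N),
          (∀ (N : ℕ) (T_L T_R : ℝ), 0 < T_L → 0 < T_R →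
            (Literature.MathematicalPhysics.KineticTheory.HeatConduction.pinnedChain ω₂ lam β γ).IsSteadyState N T_L T_R (μ N T_L T_R)) →
          ∀ Dn : ℕ → ℝ,
            (∀ N : ℕ, Filter.Tendsto (fun δ : ℝ =>
                (Literature.MathematicalPhysics.KineticTheory.HeatConduction.pinnedChain ω₂ lam β γ).totalCurrent
                  (μ N (T + δ / 2) (T - δ / 2)) / δ)
              (nhdsWithin 0 {(0 : ℝ)}ᶜ) (nhds (Dn N))) →
            ∃ c : ℝ, 0 < c ∧ ∃ N₁ : ℕ, ∀ N : ℕ, N₁ ≤ N → c ≤ Dn N := by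
  intro h ω₂ lam β γ hω hl hβ hγ hU T hT hwit μ hμ Dn hDn
  obtain ⟨μT, D, κ, ⟨-, -, -, hκ, -⟩, hfam⟩ := h ω₂ lam β γ hω hl hβ hγ hU T hT hwit
  have hlim : Tendsto Dn atTop (𝓝 κ) := hfam μ hμ Dn hDn
  have hev : ∀ᶠ N in atTop, κ / 2 ≤ Dn N :=
    hlim.eventually (eventually_ge_nhds (by linarith : κ / 2 < κ))
  obtain ⟨N₁, hN₁⟩ := hev.exists_forall_of_atTop
  exact ⟨κ / 2, by positivity, N₁, hN₁⟩

/-! ## §2 The regular pair and the common limit `L` (modulo (R)) -/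

/-- **The unconditional regular pair at `T`**: the Buttà–Marchioro flow on `bmGood` and the transfer-operator state
(`stub_heatableInfrastructure`), with superstability from tightness (`InfiniteChainTightRegular`).
[cite: ButtaMarchioro2016, Thm 2.2] -/
theorem exists_regularPair (ω₂ lam β γ : ℝ) (hω : 0 < ω₂) (hl : 0 < lam) (hβ : 0 < β) (hγ : 0 < γ)
    (T : ℝ) (hT : 0 < T) :
    ∃ (μT : Measure ChainConfig) (D : InfiniteChainDynamics (pinnedChain ω₂ lam β γ)),
      (pinnedChain ω₂ lam β γ).IsChainGibbsMeasure T μT ∧ IsShiftInvariant μT ∧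
      (pinnedChain ω₂ lam β γ).HasSuperstabilityEstimate μT ∧ D.carrier ⊆ (pinnedChain ω₂ lam β γ).bmGood ∧
      D.PreservesMeasure μT ∧ (∀ t : ℝ, D.HasAbsConvergentCorrelation μT t) := by
  obtain ⟨D, hcar, hfam⟩ :=
    Summit.AtomisticToContinuum.FouriersLaw.Theorems.GreenKuboContinuation.HeatedMeasureThermalExponent.stub_heatableInfrastructure
      ω₂ lam β γ hω hl hβ hγ
  obtain ⟨μT, hG, hS, hP, hAC, -, -⟩ := hfam T hT
  haveI : IsProbabilityMeasure μT := hG.isProbabilityMeasure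
  obtain ⟨-, hss⟩ :=
    OscillatorChain.isShiftInvariant_and_hasSuperstabilityEstimate_of_tight_pinnedChain γ hω hl.le hβ.le hT hG
      (oneSiteTight_of_isShiftInvariant hS)
  exact ⟨μT, D, hG, hS, hss, hcar.subset, hP, hAC⟩

/-- **Common-limit lemma ((R) ⇒).**  For `P` (all `> 0`), weak-NESS uniqueness and `T > 0`, under (R) there are a REGULAR pair
`(μ*, D*)` and a real `L` with `∫₀^∞ e^{-νt} C_{D*}(t) dt → L` (`ν ↓ 0`) and, along EVERY steady family with responses `Dn`
at `T`, `T² · Dn N → L` ((M) fed S7, A fed (R), S3 fed `Uniq`). [cite: KunduDharNarayan2009, eqs. (8)–(15)] -/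
theorem exists_regularPair_commonLimit_of_regularity
    (hR : Summit.AtomisticToContinuum.FouriersLaw.Theses.StaticAbelianSqueeze.UniformAbelianRegularity)
    (ω₂ lam β γ : ℝ) (hω : 0 < ω₂) (hl : 0 < lam) (hβ : 0 < β) (hγ : 0 < γ)
    (hU : ∀ (N : ℕ) (T_L T_R : ℝ), 0 < T_L → 0 < T_R → ∀ μ ν : Measure (PhaseSpace N),
      (pinnedChain ω₂ lam β γ).IsSteadyState N T_L T_R μ → (pinnedChain ω₂ lam β γ).IsSteadyState N T_L T_R ν → μ = ν)
    (T : ℝ) (hT : 0 < T) :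
    ∃ (μT : Measure ChainConfig) (D : InfiniteChainDynamics (pinnedChain ω₂ lam β γ)) (L : ℝ),
      (pinnedChain ω₂ lam β γ).IsChainGibbsMeasure T μT ∧ IsShiftInvariant μT ∧
      (pinnedChain ω₂ lam β γ).HasSuperstabilityEstimate μT ∧ D.carrier ⊆ (pinnedChain ω₂ lam β γ).bmGood ∧
      D.PreservesMeasure μT ∧ (∀ t : ℝ, D.HasAbsConvergentCorrelation μT t) ∧
      Tendsto (fun ν : ℝ => MeasureTheory.integral (MeasureTheory.volume.restrict (Set.Ioi (0:ℝ)))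
          (fun t : ℝ => Real.exp (-(ν * t)) * D.currentCorrelation μT t))
        (nhdsWithin (0:ℝ) (Set.Ioi 0)) (𝓝 L) ∧
      ∀ (μ : (N : ℕ) → ℝ → ℝ → Measure (PhaseSpace N)) (Dn : ℕ → ℝ),
        (∀ (N : ℕ) (T_L T_R : ℝ), 0 < T_L → 0 < T_R →
          (pinnedChain ω₂ lam β γ).IsSteadyState N T_L T_R (μ N T_L T_R)) →
        (∀ N : ℕ, Tendsto (fun δ : ℝ =>
            (pinnedChain ω₂ lam β γ).totalCurrent (μ N (T + δ / 2) (T - δ / 2)) / δ)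
          (nhdsWithin 0 {(0 : ℝ)}ᶜ) (𝓝 (Dn N))) →
        Tendsto (fun N => T ^ 2 * Dn N) atTop (𝓝 L) := by
  obtain ⟨μT, D, hG, hS, hss, hcar, hP, hAC⟩ := exists_regularPair ω₂ lam β γ hω hl hβ hγ T hT
  have hM := stub_fixedFrequencyMatching ω₂ lam β γ hω hl hβ hγ T hT
    (stub_regularDLRUnique ω₂ lam β γ hω hl hβ hγ T hT) μT D hG hS hss hcar hP hAC
  obtain ⟨L, hA, hL⟩ := stub_anchoredDcLimitOfRegularity ω₂ lam β γ hω hl hβ hγ T hT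
    (hR ω₂ lam β γ hω hl hβ hγ T hT) _ hM
  refine ⟨μT, D, L, hG, hS, hss, hcar, hP, hAC, hL, fun μ Dn hμ hDn => ?_⟩
  have hKq : ∀ (N : ℕ) (hN : 2 ≤ N), T ^ 2 * Dn N = ∑ k : Fin N, ∫ t in Set.Ioi (0 : ℝ),
      ∫ z, (pinnedChain ω₂ lam β γ).bondCurrent N ⟨(N - 1) / 2, by omega⟩ z *
        (∫ y, (pinnedChain ω₂ lam β γ).bondCurrent N k y
          ∂((pinnedChain ω₂ lam β γ).transitionKernel N T T t.toNNReal z))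
        ∂((pinnedChain ω₂ lam β γ).gibbsMeasure N T) := fun N hN =>
    (stub_anchoredKuboOfUniformMixing ω₂ lam β γ hω hl hβ hγ hU T hT μ Dn hμ hDn N hN
      (stub_uniformMixing ω₂ lam β γ hω hl hβ hγ T hT N hN)).2
  refine hA.congr' ?_
  filter_upwards [eventually_ge_atTop 2] with N hN
  rw [dif_pos hN]
  exact (hKq N hN).symm

/-! ## §3 The REPAIRED crux from (R) alone (the seam route) -/

/-- **(R) ⇒ the repaired crux.**  If the HYPOTHESIS witness clause carries `IsShiftInvariant μT` (the planner-level repair of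
`AbelThermodynamicLimit`), the crux's conclusion follows from (R) and the landed theorems WITHOUT the positivity item: a
shift-invariant DLR state is one-site tight, hence superstable (`InfiniteChainTightRegular`);
`regularWitness_of_regularState_of_aeOrbits` makes the carrier `⊆ bmGood`; for this regular witness (M) + A[(R)] pin
`L = T²κ > 0`, and S3 gives `Dn → κ`. [cite: BonettoLebowitzReyBellet2000, §7 eq. (37)] -/
theorem stub_repairedCruxOfRegularity :
    Summit.AtomisticToContinuum.FouriersLaw.Theses.StaticAbelianSqueeze.UniformAbelianRegularity →
    ∀ ω₂ lam β γ : ℝ, 0 < ω₂ → 0 < lam → 0 < β → 0 < γ →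
      (∀ (N : ℕ) (T_L T_R : ℝ), 0 < T_L → 0 < T_R →
        ∀ μ ν : MeasureTheory.Measure (Literature.MathematicalPhysics.KineticTheory.HeatConduction.PhaseSpace N),
          (Literature.MathematicalPhysics.KineticTheory.HeatConduction.pinnedChain ω₂ lam β γ).IsSteadyState N T_L T_R μ →
          (Literature.MathematicalPhysics.KineticTheory.HeatConduction.pinnedChain ω₂ lam β γ).IsSteadyState N T_L T_R ν → μ = ν) →
      ∀ T : ℝ, 0 < T →
        (∃ (μT : MeasureTheory.Measure Literature.MathematicalPhysics.KineticTheory.HeatConduction.ChainConfig)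
            (D : Literature.MathematicalPhysics.KineticTheory.HeatConduction.InfiniteChainDynamics
              (Literature.MathematicalPhysics.KineticTheory.HeatConduction.pinnedChain ω₂ lam β γ)) (κ : ℝ),
          (Literature.MathematicalPhysics.KineticTheory.HeatConduction.pinnedChain ω₂ lam β γ).IsChainGibbsMeasure T μT ∧
          Literature.MathematicalPhysics.KineticTheory.HeatConduction.IsShiftInvariant μT ∧
          D.PreservesMeasure μT ∧ (∀ t : ℝ, D.HasAbsConvergentCorrelation μT t) ∧ 0 < κ ∧
          Filter.Tendsto (fun ν : ℝ => (T ^ 2)⁻¹ *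
            MeasureTheory.integral (MeasureTheory.volume.restrict (Set.Ioi (0:ℝ)))
              (fun t : ℝ => Real.exp (-(ν * t)) * D.currentCorrelation μT t))
            (nhdsWithin (0:ℝ) (Set.Ioi 0)) (nhds κ)) →
        ∃ (μT : MeasureTheory.Measure Literature.MathematicalPhysics.KineticTheory.HeatConduction.ChainConfig)
            (D : Literature.MathematicalPhysics.KineticTheory.HeatConduction.InfiniteChainDynamics
              (Literature.MathematicalPhysics.KineticTheory.HeatConduction.pinnedChain ω₂ lam β γ)) (κ : ℝ),
          ((Literature.MathematicalPhysics.KineticTheory.HeatConduction.pinnedChain ω₂ lam β γ).IsChainGibbsMeasure T μT ∧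
            D.PreservesMeasure μT ∧ (∀ t : ℝ, D.HasAbsConvergentCorrelation μT t) ∧ 0 < κ ∧
            Filter.Tendsto (fun ν : ℝ => (T ^ 2)⁻¹ *
              MeasureTheory.integral (MeasureTheory.volume.restrict (Set.Ioi (0:ℝ)))
                (fun t : ℝ => Real.exp (-(ν * t)) * D.currentCorrelation μT t))
              (nhdsWithin (0:ℝ) (Set.Ioi 0)) (nhds κ)) ∧
          ∀ μ : (N : ℕ) → ℝ → ℝ → MeasureTheory.Measure (Literature.MathematicalPhysics.KineticTheory.HeatConduction.PhaseSpace N),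
            (∀ (N : ℕ) (T_L T_R : ℝ), 0 < T_L → 0 < T_R →
              (Literature.MathematicalPhysics.KineticTheory.HeatConduction.pinnedChain ω₂ lam β γ).IsSteadyState N T_L T_R (μ N T_L T_R)) →
            ∀ Dn : ℕ → ℝ,
              (∀ N : ℕ, Filter.Tendsto (fun δ : ℝ =>
                  (Literature.MathematicalPhysics.KineticTheory.HeatConduction.pinnedChain ω₂ lam β γ).totalCurrent
                    (μ N (T + δ / 2) (T - δ / 2)) / δ)
                (nhdsWithin 0 {(0 : ℝ)}ᶜ) (nhds (Dn N))) →
              Filter.Tendsto Dn Filter.atTop (nhds κ) := by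
  intro hR ω₂ lam β γ hω hl hβ hγ hU T hT hwit
  obtain ⟨μ₁, D₁, κ₁, hG₁, hS₁, hP₁, hAC₁, hκ₁, hlim₁⟩ := hwit
  haveI : IsProbabilityMeasure μ₁ := hG₁.isProbabilityMeasure
  obtain ⟨-, hss₁⟩ :=
    OscillatorChain.isShiftInvariant_and_hasSuperstabilityEstimate_of_tight_pinnedChain γ hω hl.le hβ.le hT hG₁
      (oneSiteTight_of_isShiftInvariant hS₁)
  have horb : ∀ᵐ σ ∂μ₁, ∀ t : ℝ, D₁.flow t σ ∈ (pinnedChain ω₂ lam β γ).bmGood :=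
    OscillatorChain.ae_forall_flow_mem_bmGood_pinnedChain γ hω.le hl hβ hss₁ D₁ hP₁
  obtain ⟨μT, D, κ, hG, hS, hss, hcar, hP, hAC, hκ, hAbel⟩ :=
    Summit.AtomisticToContinuum.FouriersLaw.Theorems.GreenKuboContinuation.TemperatureBlindVitaliHurwitz.regularWitness_of_regularState_of_aeOrbits
      D₁ hG₁ hP₁ hAC₁ hκ₁ hlim₁ hS₁ hss₁ horb
  refine ⟨μT, D, κ, ⟨hG, hP, hAC, hκ, hAbel⟩, ?_⟩
  intro μ hμ Dn hDn
  have hT2 : (T ^ 2) ≠ 0 := pow_ne_zero 2 hT.ne'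
  have hM := stub_fixedFrequencyMatching ω₂ lam β γ hω hl hβ hγ T hT
    (stub_regularDLRUnique ω₂ lam β γ hω hl hβ hγ T hT) μT D hG hS hss hcar hP hAC
  obtain ⟨L, hA, hL⟩ := stub_anchoredDcLimitOfRegularity ω₂ lam β γ hω hl hβ hγ T hT
    (hR ω₂ lam β γ hω hl hβ hγ T hT) _ hM
  have hAbel' : Tendsto (fun ν : ℝ => ∫ t in Ioi (0 : ℝ),
      Real.exp (-(ν * t)) * D.currentCorrelation μT t) (𝓝[>] 0) (𝓝 (T ^ 2 * κ)) := by
    have h := hAbel.const_mul (T ^ 2)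
    simp only [← mul_assoc, mul_inv_cancel₀ hT2, one_mul] at h
    exact h
  have hLκ : L = T ^ 2 * κ := tendsto_nhds_unique hL hAbel'
  have hKq : ∀ (N : ℕ) (hN : 2 ≤ N), T ^ 2 * Dn N = ∑ k : Fin N, ∫ t in Set.Ioi (0 : ℝ),
      ∫ z, (pinnedChain ω₂ lam β γ).bondCurrent N ⟨(N - 1) / 2, by omega⟩ z *
        (∫ y, (pinnedChain ω₂ lam β γ).bondCurrent N k y
          ∂((pinnedChain ω₂ lam β γ).transitionKernel N T T t.toNNReal z))
        ∂((pinnedChain ω₂ lam β γ).gibbsMeasure N T) := fun N hN =>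
    (stub_anchoredKuboOfUniformMixing ω₂ lam β γ hω hl hβ hγ hU T hT μ Dn hμ hDn N hN
      (stub_uniformMixing ω₂ lam β γ hω hl hβ hγ T hT N hN)).2
  have hd : (fun N : ℕ => if hN : 2 ≤ N then
      ∑ k : Fin N, ∫ t in Set.Ioi (0 : ℝ),
        ∫ z, (pinnedChain ω₂ lam β γ).bondCurrent N ⟨(N - 1) / 2, by omega⟩ z *
          (∫ y, (pinnedChain ω₂ lam β γ).bondCurrent N k y
            ∂((pinnedChain ω₂ lam β γ).transitionKernel N T T t.toNNReal z))
        ∂((pinnedChain ω₂ lam β γ).gibbsMeasure N T) else 0) =ᶠ[atTop] fun N => T ^ 2 * Dn N := by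
    filter_upwards [eventually_ge_atTop 2] with N hN
    rw [dif_pos hN]
    exact (hKq N hN).symm
  have hlim : Tendsto (fun N => T ^ 2 * Dn N) atTop (𝓝 (T ^ 2 * κ)) := by
    rw [← hLκ]
    exact hA.congr' hd
  have := hlim.const_mul ((T ^ 2)⁻¹)
  simpa [← mul_assoc, inv_mul_cancel₀ hT2] using this

/-! ## §4 The crux modulo the two existing items (R) and CLB -/

/-- **(R) → CLB → `EmbeddedDrudeMourre.AbelThermodynamicLimit` (the crux BY NAME).**  Proof: the regular pair `(μ*, D*)` and
the common limit `L` (`exists_regularPair_commonLimit_of_regularity`, uses (R)); positivity `0 < L` from CLB along the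
CANONICAL steady family (`exists_steadyFamily_response`): `T²·Dc N → L` and `Dc N ≥ c > 0` eventually, so `L ≥ T²c`; OUTPUT
the witness `(μ*, D*, L/T²)` (DLR, `μ*`-preserving, absolutely convergent correlations, Abel limit `L/T²` by (M) + A); along
the given family `Dn N = (T²)⁻¹(T²·Dn N) → L/T²`.  The crux's own (γ-blind) witness hypothesis is not used.
[cite: BonettoLebowitzReyBellet2000, §7 eq. (37)] [cite: KunduDharNarayan2009, eqs. (8)–(15)] -/
theorem stub_cruxOfRegularityOfLowerBound :
    Summit.AtomisticToContinuum.FouriersLaw.Theses.StaticAbelianSqueeze.UniformAbelianRegularity →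
      Summit.AtomisticToContinuum.FouriersLaw.Theses.StaticAbelianSqueeze.ConductanceLowerBound →
      Summit.AtomisticToContinuum.FouriersLaw.Theses.EmbeddedDrudeMourre.AbelThermodynamicLimit := by
  intro hR hCLB ω₂ lam β γ hω hl hβ hγ hU T hT _hwit
  have hT2 : (T ^ 2) ≠ 0 := pow_ne_zero 2 hT.ne'
  have hT2pos : 0 < T ^ 2 := pow_pos hT 2
  obtain ⟨μT, D, L, hG, -, -, -, hP, hAC, hL, hKubo⟩ :=
    exists_regularPair_commonLimit_of_regularity hR ω₂ lam β γ hω hl hβ hγ hU T hT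
  -- positivity of `L` from ConductanceLowerBound along the canonical family
  obtain ⟨μc, Dc, hμc, hDc⟩ := exists_steadyFamily_response ω₂ lam β γ hω hl hβ hγ hU T hT
  obtain ⟨c, hc, N₁, hN₁⟩ := hCLB ω₂ lam β γ hω hl hβ hγ hU μc hμc T hT Dc hDc
  have hLpos : 0 < L := by
    have h1 : T ^ 2 * c ≤ L := by
      refine ge_of_tendsto (hKubo μc Dc hμc hDc) ?_
      filter_upwards [eventually_ge_atTop N₁] with N hN
      exact mul_le_mul_of_nonneg_left (hN₁ N hN) hT2pos.le
    exact lt_of_lt_of_le (mul_pos hT2pos hc) h1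
  -- OUTPUT the witness `(μ*, D*, L/T²)`
  refine ⟨μT, D, (T ^ 2)⁻¹ * L, ⟨hG, hP, hAC, mul_pos (inv_pos.2 hT2pos) hLpos, hL.const_mul _⟩, ?_⟩
  intro μ hμ Dn hDn
  have := (hKubo μ Dn hμ hDn).const_mul ((T ^ 2)⁻¹)
  simpa [← mul_assoc, inv_mul_cancel₀ hT2] using this

end Summit.AtomisticToContinuum.FouriersLaw.Theorems.AbelThermodynamicLimit.LoomisCompactHorizonWitness

end
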